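import Summits.ValiantsHypothesis.ValiantsHypothesis.Theorems.KPlusLogSqLawTropicalBPureChainCut

/-!
# `TropicalB` (stmt-ValiantsHypothesis-19771) — PURE THREE-REGISTER CHAINS, part 2: the `L·log L` LAW
# (`≤ (4N₁+6N₂+4N₃+2)·L·(⌊log₂ L⌋+1)` dominant members; Gajjar–Radhakrishnan's thin-grid bound for four rows, with multiplicities)

Helper file for the crux `Theses.KPlusLogSqLaw.TropicalB` (`--supports stmt-ValiantsHypothesis-19771 --as helper`), cell
`pub-symmetroid`, seat val-sym-trop-p2 (g7); continues parts 1a/1b (`…TropicalBPureChainRecords`, `…TropicalBPureChainCut`, same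
hypotheses verbatim).  HONEST FRAMING: a structure theorem about a SUB-FAMILY of the terms of an ARBITRARY design — a PURE CHAIN of
three registers (`N₁, N₂, N₃` lines per position on a common window of `L` positions, coupled only through `y < z < w`), which is
the parametric-shortest-path family of the directed grid `Υ_{4,L}` with parallel edges; the in-print bound for `Υ_{p,q}` is
`O(q·(log q)^{p−3})` (Gajjar–Radhakrishnan, «Parametric shortest paths in planar graphs», 2018/2019, App. B, Thm 53), here `p = 4`.
The family lives inside the Hessenberg sector, where `TropicalB` holds (`tropicalB_hessenberg`); nothing here bears on `TropicalB`
in its window, on `WeakLifting`, on `MatrixDescartes` (stmt-ValiantsHypothesis-18050) or on VP ≠ VNP.  Companion laws in the tree: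
two registers are LINEAR (`ComparabilityLinear.card_dominant_le_linear`, `(3(N+U)+1)·L`, p487811); isotone registers of any length
are additive (`IsotoneRegisters.card_dominant_le`, p501272); the three-register family with a COMPLETE middle pair-register is cubic
(`ComparabilityChain.card_dominant_le_three'`, p500874) and that bound is attained up to its constant (memo
HOME/val-sym-trop-p2/g7/CUBIC-ABSTRACT.md, located).

## Statement (`card_dominant_le_log`)
At most `(4N₁ + 6N₂ + 4N₃ + 2)·L·(⌊log₂ L⌋ + 1)` members `(j,y,k,z,u,w)` with `y < z < w` are dominant.

## Proof (halving on the common window, Thm 53 of Gajjar–Radhakrishnan)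
`card_straddle_le_mirror`: the cut law of part 1b for the cut between the SECOND and the THIRD register (apply part 1b to the
reversed family `(u, rev w, k, rev z, j, rev y)`).  `card_window_straddle_le`: both cut laws for the sub-family of members living in
a window `[lo, lo+len)` (re-index the positions by `x ↦ lo + x`; the window family satisfies the same hypotheses with `L := len`).
`card_window_le`: a member inside a window of length `len ≤ 2^k` lies inside the left half, inside the right half, or straddles the
midpoint with its first|second or its second|third gap; the two straddling classes cost `≤ (4N₁+6N₂+4N₃+2)·len` by the window cut
laws, so by induction `#members ≤ (4N₁+6N₂+4N₃+2)·len·k`; take `k = ⌊log₂ L⌋ + 1`. [the recursion is Gajjar–Radhakrishnan's]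
-/

set_option linter.dupNamespace false
set_option autoImplicit false

namespace Summit.ValiantsHypothesis.ValiantsHypothesis.Theorems.KPlusLogSqLaw.PureChain

open Summit.ValiantsHypothesis.ValiantsHypothesis.Theorems.MatrixDescartes.Negative
open Finset

section Family

variable {m K N₁ N₂ N₃ L : ℕ}
  (d : Fin K → ℕ) (v ε : Fin m → Fin m → Fin K → ℤ)
  (τ : Fin N₁ → Fin L → Fin N₂ → Fin L → Fin N₃ → Fin L → Equiv.Perm (Fin m) × (Fin m → Fin K))
  (s₁ : Fin N₁ → Fin L → ℤ) (s₂ : Fin N₂ → Fin L → ℤ) (s₃ : Fin N₃ → Fin L → ℤ)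
  (A₁ : Fin N₁ → Fin L → ℤ) (A₂ : Fin N₂ → Fin L → ℤ) (A₃ : Fin N₃ → Fin L → ℤ)
  (hinj : ∀ j y k z u w j' y' k' z' u' w', y < z → z < w → y' < z' → z' < w' →
    τ j y k z u w = τ j' y' k' z' u' w' → j = j' ∧ y = y' ∧ k = k' ∧ z = z' ∧ u = u' ∧ w = w')
  (hpres : ∀ j y k z u w, y < z → z < w → termSign ε (τ j y k z u w) ≠ 0)
  (hw : ∀ j y k z u w (θ : ℤ), y < z → z < w →
    tropWeight d v θ (τ j y k z u w) = θ * (s₁ j y + s₂ k z + s₃ u w) - (A₁ j y + A₂ k z + A₃ u w))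

open scoped Classical in
include hinj hpres hw in
/-- **THE CUT LAW (second | third register)**, mirror of `card_straddle_le`: the dominant members with `z < c ≤ w` number at most
`N₃·(L − c) + (3(N₂+N₁)+1)·L` (part 1b applied to the reversed family `(u, rev w, k, rev z, j, rev y)`). -/
theorem card_straddle_le_mirror (c : ℕ) :
    ((Finset.univ : Finset (Fin N₁ × Fin L × Fin N₂ × Fin L × Fin N₃ × Fin L)).filter (fun i =>
        i.2.1 < i.2.2.2.1 ∧ i.2.2.2.1 < i.2.2.2.2.2 ∧ (i.2.2.2.1 : ℕ) < c ∧ c ≤ (i.2.2.2.2.2 : ℕ) ∧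
        ∃ θ : ℤ, IsDominant d v ε θ (τ i.1 i.2.1 i.2.2.1 i.2.2.2.1 i.2.2.2.2.1 i.2.2.2.2.2))).card ≤
      N₃ * (L - c) + (3 * (N₂ + N₁) + 1) * L := by
  classical
  -- the reversed family
  let τr : Fin N₃ → Fin L → Fin N₂ → Fin L → Fin N₁ → Fin L → Equiv.Perm (Fin m) × (Fin m → Fin K) :=
    fun u w' k z' j y' => τ j y'.rev k z'.rev u w'.rev
  let t₁ : Fin N₃ → Fin L → ℤ := fun u w' => s₃ u w'.rev
  let t₂ : Fin N₂ → Fin L → ℤ := fun k z' => s₂ k z'.rev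
  let t₃ : Fin N₁ → Fin L → ℤ := fun j y' => s₁ j y'.rev
  let B₁ : Fin N₃ → Fin L → ℤ := fun u w' => A₃ u w'.rev
  let B₂ : Fin N₂ → Fin L → ℤ := fun k z' => A₂ k z'.rev
  let B₃ : Fin N₁ → Fin L → ℤ := fun j y' => A₁ j y'.rev
  have hinjr : ∀ u w' k z' j y' u'' w'' k'' z'' j'' y'', w' < z' → z' < y' → w'' < z'' → z'' < y'' →
      τr u w' k z' j y' = τr u'' w'' k'' z'' j'' y'' →
      u = u'' ∧ w' = w'' ∧ k = k'' ∧ z' = z'' ∧ j = j'' ∧ y' = y'' := by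
    intro u w' k z' j y' u'' w'' k'' z'' j'' y'' h1 h2 h3 h4 he
    obtain ⟨e1, e2, e3, e4, e5, e6⟩ := hinj j y'.rev k z'.rev u w'.rev j'' y''.rev k'' z''.rev u'' w''.rev
      (Fin.rev_lt_rev.2 h2) (Fin.rev_lt_rev.2 h1) (Fin.rev_lt_rev.2 h4) (Fin.rev_lt_rev.2 h3) he
    exact ⟨e5, Fin.rev_injective e6, e3, Fin.rev_injective e4, e1, Fin.rev_injective e2⟩
  have hpresr : ∀ u w' k z' j y', w' < z' → z' < y' → termSign ε (τr u w' k z' j y') ≠ 0 :=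
    fun u w' k z' j y' h1 h2 => hpres j y'.rev k z'.rev u w'.rev (Fin.rev_lt_rev.2 h2) (Fin.rev_lt_rev.2 h1)
  have hwr : ∀ u w' k z' j y' (θ : ℤ), w' < z' → z' < y' →
      tropWeight d v θ (τr u w' k z' j y') = θ * (t₁ u w' + t₂ k z' + t₃ j y') - (B₁ u w' + B₂ k z' + B₃ j y') := by
    intro u w' k z' j y' θ h1 h2
    show tropWeight d v θ (τ j y'.rev k z'.rev u w'.rev) =
      θ * (s₃ u w'.rev + s₂ k z'.rev + s₁ j y'.rev) - (A₃ u w'.rev + A₂ k z'.rev + A₁ j y'.rev)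
    rw [hw j y'.rev k z'.rev u w'.rev θ (Fin.rev_lt_rev.2 h2) (Fin.rev_lt_rev.2 h1)]
    ring
  have hcut := card_straddle_le d v ε τr t₁ t₂ t₃ B₁ B₂ B₃ hinjr hpresr hwr (L - c)
  -- inject the mirror set into the straddle set of the reversed family
  refine le_trans ?_ hcut
  refine Finset.card_le_card_of_injOn (fun i => (i.2.2.2.2.1, i.2.2.2.2.2.rev, i.2.2.1, i.2.2.2.1.rev, i.1, i.2.1.rev)) ?_ ?_
  · intro i hi
    rw [Finset.mem_coe, Finset.mem_filter] at hi
    obtain ⟨-, hyz, hzw, hzc, hcw, θ, hθ⟩ := hi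
    rw [Finset.mem_coe, Finset.mem_filter]
    refine ⟨Finset.mem_univ _, Fin.rev_lt_rev.2 hzw, Fin.rev_lt_rev.2 hyz, ?_, ?_, θ, ?_⟩
    · rw [Fin.val_rev]; have := i.2.2.2.2.2.isLt; omega
    · rw [Fin.val_rev]; have := i.2.2.2.1.isLt; omega
    · show IsDominant d v ε θ (τ i.1 i.2.1.rev.rev i.2.2.1 i.2.2.2.1.rev.rev i.2.2.2.2.1 i.2.2.2.2.2.rev.rev)
      rw [Fin.rev_rev, Fin.rev_rev, Fin.rev_rev]
      exact hθ
  · intro i _ i' _ h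
    simp only [Prod.mk.injEq] at h
    obtain ⟨e5, e6, e3, e4, e1, e2⟩ := h
    exact Prod.ext e1 (Prod.ext (Fin.rev_injective e2) (Prod.ext e3 (Prod.ext (Fin.rev_injective e4)
      (Prod.ext e5 (Fin.rev_injective e6)))))

open scoped Classical in
include hinj hpres hw in
/-- **Both cut laws inside a window.**  For a window `[lo, lo+len) ⊆ [0, L)` and a cut `lo + c`, the dominant members living in
the window (`lo ≤ y`, `w < lo + len`) that straddle the cut with their first|second gap number at most `N₁·c + (3(N₂+N₃)+1)·len`,
and those straddling it with their second|third gap at most `N₃·(len − c) + (3(N₂+N₁)+1)·len` (parts 1b / mirror applied to the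
window family, positions re-indexed by `x ↦ lo + x`). -/
theorem card_window_straddle_le (lo len : ℕ) (hle : lo + len ≤ L) (c : ℕ) :
    ((Finset.univ : Finset (Fin N₁ × Fin L × Fin N₂ × Fin L × Fin N₃ × Fin L)).filter (fun i =>
        i.2.1 < i.2.2.2.1 ∧ i.2.2.2.1 < i.2.2.2.2.2 ∧ lo ≤ (i.2.1 : ℕ) ∧ (i.2.2.2.2.2 : ℕ) < lo + len ∧
        (i.2.1 : ℕ) < lo + c ∧ lo + c ≤ (i.2.2.2.1 : ℕ) ∧
        ∃ θ : ℤ, IsDominant d v ε θ (τ i.1 i.2.1 i.2.2.1 i.2.2.2.1 i.2.2.2.2.1 i.2.2.2.2.2))).card ≤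
      N₁ * c + (3 * (N₂ + N₃) + 1) * len ∧
    ((Finset.univ : Finset (Fin N₁ × Fin L × Fin N₂ × Fin L × Fin N₃ × Fin L)).filter (fun i =>
        i.2.1 < i.2.2.2.1 ∧ i.2.2.2.1 < i.2.2.2.2.2 ∧ lo ≤ (i.2.1 : ℕ) ∧ (i.2.2.2.2.2 : ℕ) < lo + len ∧
        (i.2.2.2.1 : ℕ) < lo + c ∧ lo + c ≤ (i.2.2.2.2.2 : ℕ) ∧
        ∃ θ : ℤ, IsDominant d v ε θ (τ i.1 i.2.1 i.2.2.1 i.2.2.2.1 i.2.2.2.2.1 i.2.2.2.2.2))).card ≤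
      N₃ * (len - c) + (3 * (N₂ + N₁) + 1) * len := by
  classical
  -- the window family on `Fin len`
  let sh : Fin len → Fin L := fun x => ⟨lo + (x : ℕ), by have := x.isLt; omega⟩
  have hsh_lt : ∀ x x' : Fin len, x < x' ↔ sh x < sh x' := fun x x' => by
    simp only [Fin.lt_def, sh]; omega
  have hsh_inj : ∀ x x' : Fin len, sh x = sh x' → x = x' := fun x x' h => by
    have h' := congrArg Fin.val h; simp only [sh] at h'; exact Fin.ext (by omega)
  let τw : Fin N₁ → Fin len → Fin N₂ → Fin len → Fin N₃ → Fin len → Equiv.Perm (Fin m) × (Fin m → Fin K) :=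
    fun j y k z u w => τ j (sh y) k (sh z) u (sh w)
  let t₁ : Fin N₁ → Fin len → ℤ := fun j y => s₁ j (sh y)
  let t₂ : Fin N₂ → Fin len → ℤ := fun k z => s₂ k (sh z)
  let t₃ : Fin N₃ → Fin len → ℤ := fun u w => s₃ u (sh w)
  let B₁ : Fin N₁ → Fin len → ℤ := fun j y => A₁ j (sh y)
  let B₂ : Fin N₂ → Fin len → ℤ := fun k z => A₂ k (sh z)
  let B₃ : Fin N₃ → Fin len → ℤ := fun u w => A₃ u (sh w)
  have hinjw : ∀ j y k z u w j' y' k' z' u' w', y < z → z < w → y' < z' → z' < w' →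
      τw j y k z u w = τw j' y' k' z' u' w' → j = j' ∧ y = y' ∧ k = k' ∧ z = z' ∧ u = u' ∧ w = w' := by
    intro j y k z u w j' y' k' z' u' w' h1 h2 h3 h4 he
    obtain ⟨e1, e2, e3, e4, e5, e6⟩ := hinj j (sh y) k (sh z) u (sh w) j' (sh y') k' (sh z') u' (sh w')
      ((hsh_lt _ _).1 h1) ((hsh_lt _ _).1 h2) ((hsh_lt _ _).1 h3) ((hsh_lt _ _).1 h4) he
    exact ⟨e1, hsh_inj _ _ e2, e3, hsh_inj _ _ e4, e5, hsh_inj _ _ e6⟩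
  have hpresw : ∀ j y k z u w, y < z → z < w → termSign ε (τw j y k z u w) ≠ 0 :=
    fun j y k z u w h1 h2 => hpres j (sh y) k (sh z) u (sh w) ((hsh_lt _ _).1 h1) ((hsh_lt _ _).1 h2)
  have hww : ∀ j y k z u w (θ : ℤ), y < z → z < w →
      tropWeight d v θ (τw j y k z u w) = θ * (t₁ j y + t₂ k z + t₃ u w) - (B₁ j y + B₂ k z + B₃ u w) :=
    fun j y k z u w θ h1 h2 => hw j (sh y) k (sh z) u (sh w) θ ((hsh_lt _ _).1 h1) ((hsh_lt _ _).1 h2)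
  have hcut₁ := card_straddle_le d v ε τw t₁ t₂ t₃ B₁ B₂ B₃ hinjw hpresw hww c
  have hcut₂ := card_straddle_le_mirror d v ε τw t₁ t₂ t₃ B₁ B₂ B₃ hinjw hpresw hww c
  -- the empty window
  rcases Nat.eq_zero_or_pos len with hlen0 | hlenpos
  · subst hlen0
    constructor
    · refine le_trans (le_of_eq ?_) (Nat.zero_le _)
      rw [Finset.card_eq_zero, Finset.filter_eq_empty_iff]
      intro i _ h
      obtain ⟨h1, h2, h3, h4, -⟩ := h
      have h1' := Fin.lt_def.1 h1; have h2' := Fin.lt_def.1 h2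
      omega
    · refine le_trans (le_of_eq ?_) (Nat.zero_le _)
      rw [Finset.card_eq_zero, Finset.filter_eq_empty_iff]
      intro i _ h
      obtain ⟨h1, h2, h3, h4, -⟩ := h
      have h1' := Fin.lt_def.1 h1; have h2' := Fin.lt_def.1 h2
      omega
  -- un-shifting a window position
  let ush : Fin L → Fin len := fun x => if h : lo ≤ (x : ℕ) ∧ (x : ℕ) < lo + len then ⟨(x : ℕ) - lo, by omega⟩ else
    ⟨0, hlenpos⟩
  have hush : ∀ x : Fin L, lo ≤ (x : ℕ) → (x : ℕ) < lo + len → sh (ush x) = x := by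
    intro x h1 h2
    apply Fin.ext
    simp only [sh, ush, dif_pos (And.intro h1 h2)]
    omega
  have hush_val : ∀ x : Fin L, lo ≤ (x : ℕ) → (x : ℕ) < lo + len → ((ush x : Fin len) : ℕ) = (x : ℕ) - lo := by
    intro x h1 h2
    simp only [ush, dif_pos (And.intro h1 h2)]
  let F : (Fin N₁ × Fin L × Fin N₂ × Fin L × Fin N₃ × Fin L) → (Fin N₁ × Fin len × Fin N₂ × Fin len × Fin N₃ × Fin len) :=
    fun i => (i.1, ush i.2.1, i.2.2.1, ush i.2.2.2.1, i.2.2.2.2.1, ush i.2.2.2.2.2)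
  -- injectivity of the un-shift on members living in the window
  have hFinj : ∀ (T : Finset (Fin N₁ × Fin L × Fin N₂ × Fin L × Fin N₃ × Fin L)),
      (∀ i ∈ T, i.2.1 < i.2.2.2.1 ∧ i.2.2.2.1 < i.2.2.2.2.2 ∧ lo ≤ (i.2.1 : ℕ) ∧ (i.2.2.2.2.2 : ℕ) < lo + len) →
      Set.InjOn F ↑T := by
    intro T hT i hi i' hi' h
    obtain ⟨a1, a2, a3, a4⟩ := hT i (Finset.mem_coe.1 hi)
    obtain ⟨b1, b2, b3, b4⟩ := hT i' (Finset.mem_coe.1 hi')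
    have a1' := Fin.lt_def.1 a1; have a2' := Fin.lt_def.1 a2
    have b1' := Fin.lt_def.1 b1; have b2' := Fin.lt_def.1 b2
    simp only [F, Prod.mk.injEq] at h
    obtain ⟨e1, e2, e3, e4, e5, e6⟩ := h
    have f2 : i.2.1 = i'.2.1 := by
      rw [← hush i.2.1 a3 (by omega), ← hush i'.2.1 b3 (by omega), e2]
    have f4 : i.2.2.2.1 = i'.2.2.2.1 := by
      rw [← hush i.2.2.2.1 (by omega) (by omega), ← hush i'.2.2.2.1 (by omega) (by omega), e4]
    have f6 : i.2.2.2.2.2 = i'.2.2.2.2.2 := by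
      rw [← hush i.2.2.2.2.2 (by omega) a4, ← hush i'.2.2.2.2.2 (by omega) b4, e6]
    exact Prod.ext e1 (Prod.ext f2 (Prod.ext e3 (Prod.ext f4 (Prod.ext e5 f6))))
  refine ⟨le_trans ?_ hcut₁, le_trans ?_ hcut₂⟩
  · refine Finset.card_le_card_of_injOn F ?_ (hFinj _ fun i hi => ?_)
    · intro i hi
      rw [Finset.mem_coe, Finset.mem_filter] at hi
      obtain ⟨-, hyz, hzw, hlo, hhi, hyc, hcz, θ, hθ⟩ := hi
      have hyz' := Fin.lt_def.1 hyz; have hzw' := Fin.lt_def.1 hzw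
      rw [Finset.mem_coe, Finset.mem_filter]
      refine ⟨Finset.mem_univ _, ?_, ?_, ?_, ?_, θ, ?_⟩
      · show ush i.2.1 < ush i.2.2.2.1
        rw [Fin.lt_def, hush_val _ hlo (by omega), hush_val _ (by omega) (by omega)]; omega
      · show ush i.2.2.2.1 < ush i.2.2.2.2.2
        rw [Fin.lt_def, hush_val _ (by omega) (by omega), hush_val _ (by omega) hhi]; omega
      · show ((ush i.2.1 : Fin len) : ℕ) < c
        rw [hush_val _ hlo (by omega)]; omega
      · show c ≤ ((ush i.2.2.2.1 : Fin len) : ℕ)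
        rw [hush_val _ (by omega) (by omega)]; omega
      · show IsDominant d v ε θ (τ i.1 (sh (ush i.2.1)) i.2.2.1 (sh (ush i.2.2.2.1)) i.2.2.2.2.1 (sh (ush i.2.2.2.2.2)))
        rw [hush _ hlo (by omega), hush _ (by omega) (by omega), hush _ (by omega) hhi]
        exact hθ
    · exact ⟨(Finset.mem_filter.1 hi).2.1, (Finset.mem_filter.1 hi).2.2.1, (Finset.mem_filter.1 hi).2.2.2.1,
        (Finset.mem_filter.1 hi).2.2.2.2.1⟩
  · refine Finset.card_le_card_of_injOn F ?_ (hFinj _ fun i hi => ?_)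
    · intro i hi
      rw [Finset.mem_coe, Finset.mem_filter] at hi
      obtain ⟨-, hyz, hzw, hlo, hhi, hzc, hcw, θ, hθ⟩ := hi
      have hyz' := Fin.lt_def.1 hyz; have hzw' := Fin.lt_def.1 hzw
      rw [Finset.mem_coe, Finset.mem_filter]
      refine ⟨Finset.mem_univ _, ?_, ?_, ?_, ?_, θ, ?_⟩
      · show ush i.2.1 < ush i.2.2.2.1
        rw [Fin.lt_def, hush_val _ hlo (by omega), hush_val _ (by omega) (by omega)]; omega
      · show ush i.2.2.2.1 < ush i.2.2.2.2.2
        rw [Fin.lt_def, hush_val _ (by omega) (by omega), hush_val _ (by omega) hhi]; omega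
      · show ((ush i.2.2.2.1 : Fin len) : ℕ) < c
        rw [hush_val _ (by omega) (by omega)]; omega
      · show c ≤ ((ush i.2.2.2.2.2 : Fin len) : ℕ)
        rw [hush_val _ (by omega) hhi]; omega
      · show IsDominant d v ε θ (τ i.1 (sh (ush i.2.1)) i.2.2.1 (sh (ush i.2.2.2.1)) i.2.2.2.2.1 (sh (ush i.2.2.2.2.2)))
        rw [hush _ hlo (by omega), hush _ (by omega) (by omega), hush _ (by omega) hhi]
        exact hθ
    · exact ⟨(Finset.mem_filter.1 hi).2.1, (Finset.mem_filter.1 hi).2.2.1, (Finset.mem_filter.1 hi).2.2.2.1,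
        (Finset.mem_filter.1 hi).2.2.2.2.1⟩

open scoped Classical in
include hinj hpres hw in
/-- **Window bound by halving.**  For every window `[lo, lo+len) ⊆ [0, L)` with `len ≤ 2^k`, the dominant members living in the
window number at most `(4N₁ + 6N₂ + 4N₃ + 2)·len·k`. -/
theorem card_window_le (k : ℕ) : ∀ lo len : ℕ, len ≤ 2 ^ k → lo + len ≤ L →
    ((Finset.univ : Finset (Fin N₁ × Fin L × Fin N₂ × Fin L × Fin N₃ × Fin L)).filter (fun i =>
        i.2.1 < i.2.2.2.1 ∧ i.2.2.2.1 < i.2.2.2.2.2 ∧ lo ≤ (i.2.1 : ℕ) ∧ (i.2.2.2.2.2 : ℕ) < lo + len ∧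
        ∃ θ : ℤ, IsDominant d v ε θ (τ i.1 i.2.1 i.2.2.1 i.2.2.2.1 i.2.2.2.2.1 i.2.2.2.2.2))).card ≤
      (4 * N₁ + 6 * N₂ + 4 * N₃ + 2) * len * k := by
  classical
  induction k with
  | zero =>
    intro lo len hlen _
    -- a window of length ≤ 1 holds no member (three distinct positions are needed)
    have hempty : ((Finset.univ : Finset (Fin N₁ × Fin L × Fin N₂ × Fin L × Fin N₃ × Fin L)).filter (fun i =>
        i.2.1 < i.2.2.2.1 ∧ i.2.2.2.1 < i.2.2.2.2.2 ∧ lo ≤ (i.2.1 : ℕ) ∧ (i.2.2.2.2.2 : ℕ) < lo + len ∧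
        ∃ θ : ℤ, IsDominant d v ε θ (τ i.1 i.2.1 i.2.2.1 i.2.2.2.1 i.2.2.2.2.1 i.2.2.2.2.2))) = ∅ := by
      apply Finset.filter_eq_empty_iff.2
      intro i _ h
      obtain ⟨h1, h2, h3, h4, -⟩ := h
      have h1' := Fin.lt_def.1 h1; have h2' := Fin.lt_def.1 h2
      simp only [pow_zero] at hlen
      omega
    rw [hempty, Finset.card_empty]
    exact Nat.zero_le _
  | succ k ih =>
    intro lo len hlen hle
    have hpow : 2 ^ (k + 1) = 2 * 2 ^ k := by ring
    obtain ⟨h₁, d₂, e1, hh₁le, hh₂le⟩ : ∃ h₁ d₂ : ℕ, h₁ + d₂ = len ∧ h₁ ≤ 2 ^ k ∧ d₂ ≤ 2 ^ k :=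
      ⟨len / 2, len - len / 2, by omega, by omega, by omega⟩
    -- the four classes
    set S := (Finset.univ : Finset (Fin N₁ × Fin L × Fin N₂ × Fin L × Fin N₃ × Fin L)).filter (fun i =>
        i.2.1 < i.2.2.2.1 ∧ i.2.2.2.1 < i.2.2.2.2.2 ∧ lo ≤ (i.2.1 : ℕ) ∧ (i.2.2.2.2.2 : ℕ) < lo + len ∧
        ∃ θ : ℤ, IsDominant d v ε θ (τ i.1 i.2.1 i.2.2.1 i.2.2.2.1 i.2.2.2.2.1 i.2.2.2.2.2)) with hS
    set SL := (Finset.univ : Finset (Fin N₁ × Fin L × Fin N₂ × Fin L × Fin N₃ × Fin L)).filter (fun i =>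
        i.2.1 < i.2.2.2.1 ∧ i.2.2.2.1 < i.2.2.2.2.2 ∧ lo ≤ (i.2.1 : ℕ) ∧ (i.2.2.2.2.2 : ℕ) < lo + h₁ ∧
        ∃ θ : ℤ, IsDominant d v ε θ (τ i.1 i.2.1 i.2.2.1 i.2.2.2.1 i.2.2.2.2.1 i.2.2.2.2.2)) with hSL
    set SR := (Finset.univ : Finset (Fin N₁ × Fin L × Fin N₂ × Fin L × Fin N₃ × Fin L)).filter (fun i =>
        i.2.1 < i.2.2.2.1 ∧ i.2.2.2.1 < i.2.2.2.2.2 ∧ lo + h₁ ≤ (i.2.1 : ℕ) ∧ (i.2.2.2.2.2 : ℕ) < (lo + h₁) + d₂ ∧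
        ∃ θ : ℤ, IsDominant d v ε θ (τ i.1 i.2.1 i.2.2.1 i.2.2.2.1 i.2.2.2.2.1 i.2.2.2.2.2)) with hSR
    set S12 := (Finset.univ : Finset (Fin N₁ × Fin L × Fin N₂ × Fin L × Fin N₃ × Fin L)).filter (fun i =>
        i.2.1 < i.2.2.2.1 ∧ i.2.2.2.1 < i.2.2.2.2.2 ∧ lo ≤ (i.2.1 : ℕ) ∧ (i.2.2.2.2.2 : ℕ) < lo + len ∧
        (i.2.1 : ℕ) < lo + h₁ ∧ lo + h₁ ≤ (i.2.2.2.1 : ℕ) ∧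
        ∃ θ : ℤ, IsDominant d v ε θ (τ i.1 i.2.1 i.2.2.1 i.2.2.2.1 i.2.2.2.2.1 i.2.2.2.2.2)) with hS12
    set S23 := (Finset.univ : Finset (Fin N₁ × Fin L × Fin N₂ × Fin L × Fin N₃ × Fin L)).filter (fun i =>
        i.2.1 < i.2.2.2.1 ∧ i.2.2.2.1 < i.2.2.2.2.2 ∧ lo ≤ (i.2.1 : ℕ) ∧ (i.2.2.2.2.2 : ℕ) < lo + len ∧
        (i.2.2.2.1 : ℕ) < lo + h₁ ∧ lo + h₁ ≤ (i.2.2.2.2.2 : ℕ) ∧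
        ∃ θ : ℤ, IsDominant d v ε θ (τ i.1 i.2.1 i.2.2.1 i.2.2.2.1 i.2.2.2.2.1 i.2.2.2.2.2)) with hS23
    have hcover : S ⊆ SL ∪ SR ∪ S12 ∪ S23 := by
      intro i hi
      rw [Finset.mem_filter] at hi
      obtain ⟨-, hyz, hzw, hlo, hhi, hdom⟩ := hi
      have hyz' := Fin.lt_def.1 hyz; have hzw' := Fin.lt_def.1 hzw
      simp only [Finset.mem_union]
      by_cases hw' : (i.2.2.2.2.2 : ℕ) < lo + h₁
      · exact Or.inl (Or.inl (Or.inl (Finset.mem_filter.2 ⟨Finset.mem_univ _, hyz, hzw, hlo, hw', hdom⟩)))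
      · by_cases hy' : lo + h₁ ≤ (i.2.1 : ℕ)
        · exact Or.inl (Or.inl (Or.inr (Finset.mem_filter.2 ⟨Finset.mem_univ _, hyz, hzw, hy', by omega, hdom⟩)))
        · by_cases hz' : lo + h₁ ≤ (i.2.2.2.1 : ℕ)
          · exact Or.inl (Or.inr (Finset.mem_filter.2 ⟨Finset.mem_univ _, hyz, hzw, hlo, hhi, by omega, hz', hdom⟩))
          · exact Or.inr (Finset.mem_filter.2 ⟨Finset.mem_univ _, hyz, hzw, hlo, hhi, by omega, by omega, hdom⟩)
    have hL := ih lo h₁ hh₁le (by omega)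
    have hR := ih (lo + h₁) d₂ hh₂le (by omega)
    obtain ⟨h12, -⟩ := card_window_straddle_le d v ε τ s₁ s₂ s₃ A₁ A₂ A₃ hinj hpres hw lo len hle h₁
    obtain ⟨-, h23⟩ := card_window_straddle_le d v ε τ s₁ s₂ s₃ A₁ A₂ A₃ hinj hpres hw lo len hle h₁
    have hsub : len - h₁ = d₂ := by omega
    rw [hsub] at h23
    have key : (4 * N₁ + 6 * N₂ + 4 * N₃ + 2) * h₁ * k + (4 * N₁ + 6 * N₂ + 4 * N₃ + 2) * d₂ * k +
        (N₁ * h₁ + (3 * (N₂ + N₃) + 1) * (h₁ + d₂)) + (N₃ * d₂ + (3 * (N₂ + N₁) + 1) * (h₁ + d₂)) +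
        (N₁ * d₂ + N₃ * h₁) = (4 * N₁ + 6 * N₂ + 4 * N₃ + 2) * (h₁ + d₂) * (k + 1) := by ring
    calc S.card ≤ (SL ∪ SR ∪ S12 ∪ S23).card := Finset.card_le_card hcover
      _ ≤ SL.card + SR.card + S12.card + S23.card := by
          refine le_trans (Finset.card_union_le _ _) ?_
          refine le_trans (Nat.add_le_add_right (Finset.card_union_le _ _) _) ?_
          exact Nat.add_le_add_right (Nat.add_le_add_right (Finset.card_union_le _ _) _) _
      _ ≤ (4 * N₁ + 6 * N₂ + 4 * N₃ + 2) * h₁ * k + (4 * N₁ + 6 * N₂ + 4 * N₃ + 2) * d₂ * k +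
            (N₁ * h₁ + (3 * (N₂ + N₃) + 1) * len) + (N₃ * d₂ + (3 * (N₂ + N₁) + 1) * len) := by
          gcongr
      _ ≤ (4 * N₁ + 6 * N₂ + 4 * N₃ + 2) * len * (k + 1) := by
          rw [← e1]
          exact le_of_le_of_eq (Nat.le_add_right _ _) key

open scoped Classical in
include hinj hpres hw in
/-- **THE `L·log L` LAW FOR PURE THREE-REGISTER CHAINS.**  Inside any design, a pure chain of three registers with `N₁, N₂, N₃`
lines per position on a common window of `L` positions (members present and pairwise distinct whenever `y < z < w`, slopes and
valuations additive) carries at most `(4N₁ + 6N₂ + 4N₃ + 2)·L·(⌊log₂ L⌋ + 1)` dominant members — Gajjar–Radhakrishnan's bound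
`O(q log q)` for the four-row grid `Υ_{4,q}`, with multiplicities. -/
theorem card_dominant_le_log :
    ((Finset.univ : Finset (Fin N₁ × Fin L × Fin N₂ × Fin L × Fin N₃ × Fin L)).filter (fun i =>
        i.2.1 < i.2.2.2.1 ∧ i.2.2.2.1 < i.2.2.2.2.2 ∧
        ∃ θ : ℤ, IsDominant d v ε θ (τ i.1 i.2.1 i.2.2.1 i.2.2.2.1 i.2.2.2.2.1 i.2.2.2.2.2))).card ≤
      (4 * N₁ + 6 * N₂ + 4 * N₃ + 2) * L * (Nat.log 2 L + 1) := by
  classical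
  have hpow : L ≤ 2 ^ (Nat.log 2 L + 1) := le_of_lt (Nat.lt_pow_succ_log_self (by norm_num) L)
  have h := card_window_le d v ε τ s₁ s₂ s₃ A₁ A₂ A₃ hinj hpres hw (Nat.log 2 L + 1) 0 L hpow (by omega)
  refine le_trans (le_of_eq (congrArg Finset.card ?_)) h
  apply Finset.filter_congr
  intro i _
  constructor
  · rintro ⟨h1, h2, h3⟩
    exact ⟨h1, h2, Nat.zero_le _, by have := i.2.2.2.2.2.isLt; omega, h3⟩
  · rintro ⟨h1, h2, -, -, h3⟩
    exact ⟨h1, h2, h3⟩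

end Family

end Summit.ValiantsHypothesis.ValiantsHypothesis.Theorems.KPlusLogSqLaw.PureChain
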